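import Summits.ResolutionOfSingularities.ResolutionOfSingularities.Theorems.DeltaCutRunCertificates
import HarnessLib

/-!
# DeltaCutRunCertificates2 — decomp-res node «RunCut» (lens-6 g25, critic row 190 CLEARED +1), tree file 6/7 of the node

Content VERBATIM from the decomp-res lens-6 g25 node `HOME/decomp-res-lens-6/g25/RunCut.lean` (pin e4e94516; NEW
part l. 1187–2651; the node's carry of g24 l. 89–1165 dropped in favour of `import …DeltaCutChain3` /
`…DeltaCutChainCertificates2`); HOME = run/shared/lean/pub/decomp-res; critic row 190 CLEARED +1; landing plan
NEXT-g26.md bfe16773 §4 + rider INBOX :1047 — provenance, critic text and the lens header in full in the first file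
of the node, `DeltaCutRun`.  Namespace `…Theorems.DeltaCutClasses`; `--supports stmt-ResolutionOfSingularities-26971`.

## This file

Continuation 2/3 of `DeltaCutRunCertificates` (same sections of the node, cut at the 400-line cap): carries
`D2_L2_chart_X1`, `D2_L2_chart_X1_dd`, `D2_L2_chart_X2`, `D2_L2_chart_X2_dd`, `D2_L2_chart_X3`.

[WRITER NOTE (decomp-res writer g12): file split only (tree files ≤ 400 lines); namespace, sections, section opens
and every declaration exactly as in the lens (the carry block and the node's global dupNamespace-linter line are
dropped — the library sets the latter; the two namespace-level `open …TwistCutClasses` / `open …LightCutClasses`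
lines of the node are replayed).]

(Sources: Hironaka1967 (characteristic polyhedra); CossartJannsenSaito2020 Def. 3.13 / Thm. 3.14, Ch. 8, Thm. 9.6;
Hironaka1970 (near points / vertices); CossartPiltant2019 Prop. 2.6; CossartPiltant2008 §2; Giraud1975; Hironaka2005
(three key theorems: order under permissible blow-up); König 1927 (Kőnig's lemma) as Mathlib
`nonempty_sections_of_finite_inverse_system`; EGAIV4 §16–§17; StacksProject 0804 / 0BIQ / 031I; Matsumura1987 §28.)
-/

noncomputable section

open CategoryTheory CategoryTheory.Limits AlgebraicGeometry TopologicalSpace IsLocalRing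
open Literature.AlgebraicGeometry.Resolution

universe u

namespace Summit.ResolutionOfSingularities.ResolutionOfSingularities.Theorems.DeltaCutClasses

open Summit.ResolutionOfSingularities.ResolutionOfSingularities.Theorems.TwistCutClasses
open Summit.ResolutionOfSingularities.ResolutionOfSingularities.Theorems.LightCutClasses

section RunCertificates

open MvPolynomial
variable {K : Type*} [Field K]

/-- **D2, LEVEL 2, chart `t` — CLASSIFICATION + TAMENESS** (`f₂ = z''³ + t(1 + u''³) + t²(u''⁴ + w''⁴)`, `0 = z'', 1
= t, 2 = u'',
3 = w''`): every prime `𝔫 ∋ t` of order `≥ 3` contains `z''`, `1 + u''` (`∂_t f₂ = 1 + u''³ + 2t·e ∈ 𝔫`, and `1 +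
u''³ = (1 + u'')³`
in characteristic `3`) and `e = u''⁴ + w''⁴` (`∂_t∂_t f₂ = 2e`), and `e` has `𝔫`-order EXACTLY `1` (`s'·e ∈ 𝔫²` would give
`w'' ∈ 𝔫` and `u'' ∈ 𝔫` by `∂_{w''}`, `∂_{u''}`, contradicting `1 + u'' ∈ 𝔫`): the point is TAME. [new; elementary]
[folklore] -/
theorem D2_L2_chart_X1 [CharP K 3] (𝔫 : Ideal (MvPolynomial (Fin 4) K)) [𝔫.IsPrime]
    (ht : (X 1 : MvPolynomial (Fin 4) K) ∈ 𝔫) {s : MvPolynomial (Fin 4) K} (hs : s ∉ 𝔫)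
    (h : s * (X 0 ^ 3 + X 1 * (1 + X 2 ^ 3) + X 1 ^ 2 * (X 2 ^ 4 + X 3 ^ 4) : MvPolynomial (Fin 4) K) ∈ 𝔫 ^ 3) :
    (X 0 : MvPolynomial (Fin 4) K) ∈ 𝔫 ∧ (1 + X 2 : MvPolynomial (Fin 4) K) ∈ 𝔫 ∧
      (X 2 ^ 4 + X 3 ^ 4 : MvPolynomial (Fin 4) K) ∈ 𝔫 ∧
        ∀ s' ∉ 𝔫, s' * (X 2 ^ 4 + X 3 ^ 4 : MvPolynomial (Fin 4) K) ∉ 𝔫 ^ 2 := by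
  have hs2 : s ^ 2 ∉ 𝔫 := pow_not_mem 𝔫 hs 2
  have hs4 : (s ^ 2) ^ 2 ∉ 𝔫 := pow_not_mem 𝔫 hs2 2
  have h2 : (2 : MvPolynomial (Fin 4) K) ∉ 𝔫 := two_not_mem (K := K) 𝔫
  have h4 : (4 : MvPolynomial (Fin 4) K) ∉ 𝔫 := by
    have := natCast_not_mem (K := K) 𝔫 (m := 4) (by decide)
    exact_mod_cast this
  have e10 := f_ne K (i := 1) (j := 0) (by decide)
  have e12 := f_ne K (i := 1) (j := 2) (by decide)
  have e13 := f_ne K (i := 1) (j := 3) (by decide)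
  have e23 := f_ne K (i := 2) (j := 3) (by decide)
  have e32 := f_ne K (i := 3) (j := 2) (by decide)
  have e11 := f_self K 1
  have e22 := f_self K 2
  have e33 := f_self K 3
  have d1 : pderiv 1 (X 0 ^ 3 + X 1 * (1 + X 2 ^ 3) + X 1 ^ 2 * (X 2 ^ 4 + X 3 ^ 4) : MvPolynomial (Fin 4) K) =
      1 + X 2 ^ 3 + 2 * (X 1 * (X 2 ^ 4 + X 3 ^ 4)) := by
    simp only [map_add, Derivation.leibniz, Derivation.leibniz_pow, smul_eq_mul, nsmul_eq_mul, e10, e11, e12, e13, f_one]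
    push_cast; ring
  have d11 : pderiv 1 (1 + X 2 ^ 3 + 2 * (X 1 * (X 2 ^ 4 + X 3 ^ 4)) : MvPolynomial (Fin 4) K) =
      2 * (X 2 ^ 4 + X 3 ^ 4) ^ 1 := by
    simp only [map_add, Derivation.leibniz, Derivation.leibniz_pow, smul_eq_mul, nsmul_eq_mul, e11, e12, e13, f_one, f_two]
    push_cast; ring
  have h1 := sq_mul_deriv_mem_pow 𝔫 h (pderiv 1)
  rw [d1] at h1
  -- `1 + u''³ ∈ 𝔫`, hence `1 + u'' ∈ 𝔫`
  have hg : (1 + X 2 ^ 3 + 2 * (X 1 * (X 2 ^ 4 + X 3 ^ 4)) : MvPolynomial (Fin 4) K) ∈ 𝔫 :=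
    (‹𝔫.IsPrime›.mem_or_mem (Ideal.pow_le_self two_ne_zero h1)).resolve_left hs2
  have hcube : (1 : MvPolynomial (Fin 4) K) ^ 3 + X 2 ^ 3 ∈ 𝔫 := by
    have := Ideal.sub_mem _ hg (Ideal.mul_mem_left _ (2 * (X 2 ^ 4 + X 3 ^ 4)) ht)
    rwa [show (1 + X 2 ^ 3 + 2 * (X 1 * (X 2 ^ 4 + X 3 ^ 4)) - 2 * (X 2 ^ 4 + X 3 ^ 4) * X 1 : MvPolynomial (Fin 4) K) =
      1 ^ 3 + X 2 ^ 3 by ring] at this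
  have h1X2 : (1 + X 2 : MvPolynomial (Fin 4) K) ∈ 𝔫 := add_mem_of_cube_add_cube_mem 𝔫 hcube
  -- `e = u''⁴ + w''⁴ ∈ 𝔫`
  have he : (X 2 ^ 4 + X 3 ^ 4 : MvPolynomial (Fin 4) K) ∈ 𝔫 := by
    have h3 := sq_mul_deriv_mem_pow 𝔫 h1 (pderiv 1)
    rw [d11] at h3
    exact mem_of_mul_mul_pow_mem_pow 𝔫 one_ne_zero hs4 h2 h3
  -- `z'' ∈ 𝔫`
  have hf : (X 0 ^ 3 + X 1 * (1 + X 2 ^ 3) + X 1 ^ 2 * (X 2 ^ 4 + X 3 ^ 4) : MvPolynomial (Fin 4) K) ∈ 𝔫 :=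
    (‹𝔫.IsPrime›.mem_or_mem (Ideal.pow_le_self three_ne_zero h)).resolve_left hs
  have hX0 : (X 0 : MvPolynomial (Fin 4) K) ∈ 𝔫 := by
    refine ‹𝔫.IsPrime›.mem_of_pow_mem 3 ?_
    have := Ideal.sub_mem _ hf (Ideal.add_mem _ (Ideal.mul_mem_right (1 + X 2 ^ 3) _ ht)
      (Ideal.mul_mem_right (X 2 ^ 4 + X 3 ^ 4) _ (Ideal.pow_mem_of_mem 𝔫 ht 2 (by norm_num))))
    rwa [show (X 0 ^ 3 + X 1 * (1 + X 2 ^ 3) + X 1 ^ 2 * (X 2 ^ 4 + X 3 ^ 4) - (X 1 * (1 + X 2 ^ 3) + X 1 ^ 2 * (X 2 ^ 4 + X 3 ^ 4)) :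
      MvPolynomial (Fin 4) K) = X 0 ^ 3 by ring] at this
  refine ⟨hX0, h1X2, he, fun s' hs' hmem => ?_⟩
  -- TAMENESS: `e` is a regular parameter at `𝔫`
  have hs'2 : s' ^ 2 ∉ 𝔫 := pow_not_mem 𝔫 hs' 2
  have de3 : pderiv 3 (X 2 ^ 4 + X 3 ^ 4 : MvPolynomial (Fin 4) K) = 4 * X 3 ^ 3 := by
    simp only [map_add, Derivation.leibniz_pow, smul_eq_mul, nsmul_eq_mul, e32, e33]
    push_cast; ring
  have de2 : pderiv 2 (X 2 ^ 4 + X 3 ^ 4 : MvPolynomial (Fin 4) K) = 4 * X 2 ^ 3 := by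
    simp only [map_add, Derivation.leibniz_pow, smul_eq_mul, nsmul_eq_mul, e22, e23]
    push_cast; ring
  have hX2 : (X 2 : MvPolynomial (Fin 4) K) ∈ 𝔫 := by
    have h3 := sq_mul_deriv_mem_pow 𝔫 hmem (pderiv 2)
    rw [de2] at h3
    exact mem_of_mul_mul_pow_mem_pow 𝔫 one_ne_zero hs'2 h4 h3
  have h1mem : (1 : MvPolynomial (Fin 4) K) ∈ 𝔫 := by
    have := Ideal.sub_mem _ h1X2 hX2
    rwa [add_sub_cancel_right] at this
  exact one_not_mem_of_isPrime 𝔫 h1mem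

/-- `∂_t∂_t f₂ = 2·(u''⁴ + w''⁴)` in chart `t` of level 2 (the absolute differential operator extracting the tame
element). [elementary] [folklore] -/
theorem D2_L2_chart_X1_dd :
    (pderiv 1) ((pderiv 1) (X 0 ^ 3 + X 1 * (1 + X 2 ^ 3) + X 1 ^ 2 * (X 2 ^ 4 + X 3 ^ 4) : MvPolynomial (Fin 4) K)) =
      2 * (X 2 ^ 4 + X 3 ^ 4) := by
  have e10 := f_ne K (i := 1) (j := 0) (by decide)
  have e12 := f_ne K (i := 1) (j := 2) (by decide)
  have e13 := f_ne K (i := 1) (j := 3) (by decide)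
  have e11 := f_self K 1
  have h1 : (pderiv 1) (X 0 ^ 3 + X 1 * (1 + X 2 ^ 3) + X 1 ^ 2 * (X 2 ^ 4 + X 3 ^ 4) : MvPolynomial (Fin 4) K) =
      1 + X 2 ^ 3 + 2 * (X 1 * (X 2 ^ 4 + X 3 ^ 4)) := by
    simp only [map_add, Derivation.leibniz, Derivation.leibniz_pow, smul_eq_mul, nsmul_eq_mul, e10, e11, e12, e13, f_one]
    push_cast; ring
  rw [h1]
  simp only [map_add, Derivation.leibniz, Derivation.leibniz_pow, smul_eq_mul, nsmul_eq_mul, e11, e12, e13, f_one, f_two]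
  push_cast; ring

/-- **D2, LEVEL 2, chart `u'` — CLASSIFICATION + TAMENESS** (`f₂ = z''³ + t''u'(1 + u' + t''³ + u'w''⁴)`, `0 = z'',
1 = t'', 2 = u',
3 = w''`): every prime `𝔫 ∋ u'` of order `≥ 3` contains `z''`, `1 + t''` (`∂_{t''}∂_{u'} f₂ ≡ 1 + 4t''³ (mod u')`,
`= (1 + t'')³` in
characteristic `3`), `1 + w''⁴` (`∂_{u'}∂_{u'} f₂ = 2t''(1 + w''⁴)` and `t'' ∉ 𝔫`), and the extracted element `e =
t''(1 + w''⁴) ∈ 𝔫`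
has `𝔫`-order EXACTLY `1` (`s'·e ∈ 𝔫²` would give `t''w''³ ∈ 𝔫` by `∂_{w''}`): the point is TAME. [new; elementary]
[folklore] -/
theorem D2_L2_chart_X2 [CharP K 3] (𝔫 : Ideal (MvPolynomial (Fin 4) K)) [𝔫.IsPrime]
    (hu : (X 2 : MvPolynomial (Fin 4) K) ∈ 𝔫) {s : MvPolynomial (Fin 4) K} (hs : s ∉ 𝔫)
    (h : s * (X 0 ^ 3 + X 1 * X 2 * (1 + X 2 + X 1 ^ 3 + X 2 * X 3 ^ 4) : MvPolynomial (Fin 4) K) ∈ 𝔫 ^ 3) :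
    (X 0 : MvPolynomial (Fin 4) K) ∈ 𝔫 ∧ (1 + X 1 : MvPolynomial (Fin 4) K) ∈ 𝔫 ∧
      (1 + X 3 ^ 4 : MvPolynomial (Fin 4) K) ∈ 𝔫 ∧ (X 1 * (1 + X 3 ^ 4) : MvPolynomial (Fin 4) K) ∈ 𝔫 ∧
        ∀ s' ∉ 𝔫, s' * (X 1 * (1 + X 3 ^ 4) : MvPolynomial (Fin 4) K) ∉ 𝔫 ^ 2 := by
  have hs2 : s ^ 2 ∉ 𝔫 := pow_not_mem 𝔫 hs 2
  have hs4 : (s ^ 2) ^ 2 ∉ 𝔫 := pow_not_mem 𝔫 hs2 2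
  have h2 : (2 : MvPolynomial (Fin 4) K) ∉ 𝔫 := two_not_mem (K := K) 𝔫
  have h4 : (4 : MvPolynomial (Fin 4) K) ∉ 𝔫 := by
    have := natCast_not_mem (K := K) 𝔫 (m := 4) (by decide)
    exact_mod_cast this
  have e10 := f_ne K (i := 1) (j := 0) (by decide)
  have e12 := f_ne K (i := 1) (j := 2) (by decide)
  have e13 := f_ne K (i := 1) (j := 3) (by decide)
  have e20 := f_ne K (i := 2) (j := 0) (by decide)
  have e21 := f_ne K (i := 2) (j := 1) (by decide)
  have e23 := f_ne K (i := 2) (j := 3) (by decide)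
  have e31 := f_ne K (i := 3) (j := 1) (by decide)
  have e11 := f_self K 1
  have e22 := f_self K 2
  have e33 := f_self K 3
  have d2 : pderiv 2 (X 0 ^ 3 + X 1 * X 2 * (1 + X 2 + X 1 ^ 3 + X 2 * X 3 ^ 4) : MvPolynomial (Fin 4) K) =
      X 1 + X 1 ^ 4 + 2 * (X 1 * X 2) + 2 * (X 1 * X 2 * X 3 ^ 4) := by
    simp only [map_add, Derivation.leibniz, Derivation.leibniz_pow, smul_eq_mul, nsmul_eq_mul, e20, e21, e22, e23, f_one]
    push_cast; ring
  have d21 : pderiv 1 (X 1 + X 1 ^ 4 + 2 * (X 1 * X 2) + 2 * (X 1 * X 2 * X 3 ^ 4) : MvPolynomial (Fin 4) K) =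
      1 + 4 * X 1 ^ 3 + 2 * X 2 + 2 * (X 2 * X 3 ^ 4) := by
    simp only [map_add, Derivation.leibniz, Derivation.leibniz_pow, smul_eq_mul, nsmul_eq_mul, e11, e12, e13, f_two]
    push_cast; ring
  have d22 : pderiv 2 (X 1 + X 1 ^ 4 + 2 * (X 1 * X 2) + 2 * (X 1 * X 2 * X 3 ^ 4) : MvPolynomial (Fin 4) K) =
      2 * (X 1 * (1 + X 3 ^ 4)) ^ 1 := by
    simp only [map_add, Derivation.leibniz, Derivation.leibniz_pow, smul_eq_mul, nsmul_eq_mul, e21, e22, e23, f_two]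
    push_cast; ring
  have h1 := sq_mul_deriv_mem_pow 𝔫 h (pderiv 2)
  rw [d2] at h1
  -- `1 + t''³ ∈ 𝔫`, hence `1 + t'' ∈ 𝔫`
  have h21 := sq_mul_deriv_mem_pow 𝔫 h1 (pderiv 1)
  rw [d21, pow_one] at h21
  have hg : (1 + 4 * X 1 ^ 3 + 2 * X 2 + 2 * (X 2 * X 3 ^ 4) : MvPolynomial (Fin 4) K) ∈ 𝔫 :=
    (‹𝔫.IsPrime›.mem_or_mem h21).resolve_left hs4
  have hcube : (1 : MvPolynomial (Fin 4) K) ^ 3 + X 1 ^ 3 ∈ 𝔫 := by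
    have := Ideal.sub_mem _ hg (Ideal.mul_mem_left _ (2 + 2 * X 3 ^ 4) hu)
    rw [show (1 + 4 * X 1 ^ 3 + 2 * X 2 + 2 * (X 2 * X 3 ^ 4) - (2 + 2 * X 3 ^ 4) * X 2 : MvPolynomial (Fin 4) K) =
      1 ^ 3 + X 1 ^ 3 + 3 * X 1 ^ 3 by ring, three_eq_zero_mvPolynomial, zero_mul, add_zero] at this
    exact this
  have h1X1 : (1 + X 1 : MvPolynomial (Fin 4) K) ∈ 𝔫 := add_mem_of_cube_add_cube_mem 𝔫 hcube
  have hX1n : (X 1 : MvPolynomial (Fin 4) K) ∉ 𝔫 := fun hX1 => by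
    have := Ideal.sub_mem _ h1X1 hX1
    rw [add_sub_cancel_right] at this
    exact one_not_mem_of_isPrime 𝔫 this
  -- `e = t''(1 + w''⁴) ∈ 𝔫`, hence `1 + w''⁴ ∈ 𝔫`
  have he : (X 1 * (1 + X 3 ^ 4) : MvPolynomial (Fin 4) K) ∈ 𝔫 := by
    have h3 := sq_mul_deriv_mem_pow 𝔫 h1 (pderiv 2)
    rw [d22] at h3
    exact mem_of_mul_mul_pow_mem_pow 𝔫 one_ne_zero hs4 h2 h3
  have h1X3 : (1 + X 3 ^ 4 : MvPolynomial (Fin 4) K) ∈ 𝔫 := (‹𝔫.IsPrime›.mem_or_mem he).resolve_left hX1n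
  -- `z'' ∈ 𝔫`
  have hf : (X 0 ^ 3 + X 1 * X 2 * (1 + X 2 + X 1 ^ 3 + X 2 * X 3 ^ 4) : MvPolynomial (Fin 4) K) ∈ 𝔫 :=
    (‹𝔫.IsPrime›.mem_or_mem (Ideal.pow_le_self three_ne_zero h)).resolve_left hs
  have hX0 : (X 0 : MvPolynomial (Fin 4) K) ∈ 𝔫 := by
    refine ‹𝔫.IsPrime›.mem_of_pow_mem 3 ?_
    have := Ideal.sub_mem _ hf (Ideal.mul_mem_left _ (X 1) (Ideal.mul_mem_right (1 + X 2 + X 1 ^ 3 + X 2 * X 3 ^ 4) _ hu))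
    rwa [show (X 0 ^ 3 + X 1 * X 2 * (1 + X 2 + X 1 ^ 3 + X 2 * X 3 ^ 4) - X 1 * (X 2 * (1 + X 2 + X 1 ^ 3 + X 2 * X 3 ^ 4)) :
      MvPolynomial (Fin 4) K) = X 0 ^ 3 by ring] at this
  refine ⟨hX0, h1X1, h1X3, he, fun s' hs' hmem => ?_⟩
  -- TAMENESS: `e` is a regular parameter at `𝔫`
  have hs'2 : s' ^ 2 ∉ 𝔫 := pow_not_mem 𝔫 hs' 2
  have de3 : pderiv 3 (X 1 * (1 + X 3 ^ 4) : MvPolynomial (Fin 4) K) = 4 * (X 1 * X 3 ^ 3) := by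
    simp only [map_add, Derivation.leibniz, Derivation.leibniz_pow, smul_eq_mul, nsmul_eq_mul, e31, e33, f_one]
    push_cast; ring
  have h3 := sq_mul_deriv_mem_pow 𝔫 hmem (pderiv 3)
  rw [de3, pow_one] at h3
  have h13 : (X 1 * X 3 ^ 3 : MvPolynomial (Fin 4) K) ∈ 𝔫 := by
    rcases ‹𝔫.IsPrime›.mem_or_mem h3 with h' | h'
    · exact absurd h' hs'2
    rcases ‹𝔫.IsPrime›.mem_or_mem h' with h'' | h''
    · exact absurd h'' h4
    · exact h''
  have hX3 : (X 3 : MvPolynomial (Fin 4) K) ∈ 𝔫 :=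
    ‹𝔫.IsPrime›.mem_of_pow_mem 3 ((‹𝔫.IsPrime›.mem_or_mem h13).resolve_left hX1n)
  have h1mem : (1 : MvPolynomial (Fin 4) K) ∈ 𝔫 := by
    have := Ideal.sub_mem _ h1X3 (Ideal.pow_mem_of_mem 𝔫 hX3 4 (by norm_num))
    rwa [add_sub_cancel_right] at this
  exact one_not_mem_of_isPrime 𝔫 h1mem

/-- `∂_{u'}∂_{u'} f₂ = 2·t''(1 + w''⁴)` in chart `u'` of level 2. [elementary] [folklore] -/
theorem D2_L2_chart_X2_dd :
    (pderiv 2) ((pderiv 2) (X 0 ^ 3 + X 1 * X 2 * (1 + X 2 + X 1 ^ 3 + X 2 * X 3 ^ 4) : MvPolynomial (Fin 4) K)) =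
      2 * (X 1 * (1 + X 3 ^ 4)) := by
  have e20 := f_ne K (i := 2) (j := 0) (by decide)
  have e21 := f_ne K (i := 2) (j := 1) (by decide)
  have e23 := f_ne K (i := 2) (j := 3) (by decide)
  have e22 := f_self K 2
  have h1 : (pderiv 2) (X 0 ^ 3 + X 1 * X 2 * (1 + X 2 + X 1 ^ 3 + X 2 * X 3 ^ 4) : MvPolynomial (Fin 4) K) =
      X 1 + X 1 ^ 4 + 2 * (X 1 * X 2) + 2 * (X 1 * X 2 * X 3 ^ 4) := by
    simp only [map_add, Derivation.leibniz, Derivation.leibniz_pow, smul_eq_mul, nsmul_eq_mul, e20, e21, e22, e23, f_one]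
    push_cast; ring
  rw [h1]
  simp only [map_add, Derivation.leibniz, Derivation.leibniz_pow, smul_eq_mul, nsmul_eq_mul, e21, e22, e23, f_two]
  push_cast; ring

/-- **D2, LEVEL 2, chart `w'` — CLASSIFICATION + TAMENESS** (`f₂ = z''³ + t''w'(w' + u''³ + t''³ + u''⁴w')`, `0 = z'', 1 = t'',
2 = u'', 3 = w'`; this chart contains the near point `y₂` of `y₁`, its origin): every prime `𝔫 ∋ w'` of order `≥ 3`
contains `z''`,
`t'' + u''` (`∂_{t''}∂_{w'} f₂ ≡ u''³ + 4t''³ (mod w')`, `= (t'' + u'')³` in characteristic `3`) and the extracted element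
`e = t''(1 + u''⁴)` (`∂_{w'}∂_{w'} f₂ = 2e`), which has `𝔫`-order EXACTLY `1` (`s'·e ∈ 𝔫²` gives `1 + u''⁴ ∈ 𝔫` by `∂_{t''}` and
`t''u''³ ∈ 𝔫` by `∂_{u''}`, whence `1 ∈ 𝔫`): the point is TAME. [new; elementary] [folklore] -/
theorem D2_L2_chart_X3 [CharP K 3] (𝔫 : Ideal (MvPolynomial (Fin 4) K)) [𝔫.IsPrime]
    (hw : (X 3 : MvPolynomial (Fin 4) K) ∈ 𝔫) {s : MvPolynomial (Fin 4) K} (hs : s ∉ 𝔫)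
    (h : s * (X 0 ^ 3 + X 1 * X 3 * (X 3 + X 2 ^ 3 + X 1 ^ 3 + X 2 ^ 4 * X 3) : MvPolynomial (Fin 4) K) ∈ 𝔫 ^ 3) :
    (X 0 : MvPolynomial (Fin 4) K) ∈ 𝔫 ∧ (X 1 + X 2 : MvPolynomial (Fin 4) K) ∈ 𝔫 ∧
      (X 1 * (1 + X 2 ^ 4) : MvPolynomial (Fin 4) K) ∈ 𝔫 ∧
        ∀ s' ∉ 𝔫, s' * (X 1 * (1 + X 2 ^ 4) : MvPolynomial (Fin 4) K) ∉ 𝔫 ^ 2 := by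
  have hs2 : s ^ 2 ∉ 𝔫 := pow_not_mem 𝔫 hs 2
  have hs4 : (s ^ 2) ^ 2 ∉ 𝔫 := pow_not_mem 𝔫 hs2 2
  have h2 : (2 : MvPolynomial (Fin 4) K) ∉ 𝔫 := two_not_mem (K := K) 𝔫
  have h4 : (4 : MvPolynomial (Fin 4) K) ∉ 𝔫 := by
    have := natCast_not_mem (K := K) 𝔫 (m := 4) (by decide)
    exact_mod_cast this
  have e10 := f_ne K (i := 1) (j := 0) (by decide)
  have e12 := f_ne K (i := 1) (j := 2) (by decide)
  have e13 := f_ne K (i := 1) (j := 3) (by decide)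
  have e21 := f_ne K (i := 2) (j := 1) (by decide)
  have e23 := f_ne K (i := 2) (j := 3) (by decide)
  have e30 := f_ne K (i := 3) (j := 0) (by decide)
  have e31 := f_ne K (i := 3) (j := 1) (by decide)
  have e32 := f_ne K (i := 3) (j := 2) (by decide)
  have e11 := f_self K 1
  have e22 := f_self K 2
  have e33 := f_self K 3
  have d3 : pderiv 3 (X 0 ^ 3 + X 1 * X 3 * (X 3 + X 2 ^ 3 + X 1 ^ 3 + X 2 ^ 4 * X 3) : MvPolynomial (Fin 4) K) =
      X 1 * X 2 ^ 3 + X 1 ^ 4 + 2 * (X 1 * X 3) + 2 * (X 1 * X 2 ^ 4 * X 3) := by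
    simp only [map_add, Derivation.leibniz, Derivation.leibniz_pow, smul_eq_mul, nsmul_eq_mul, e30, e31, e32, e33]
    push_cast; ring
  have d31 : pderiv 1 (X 1 * X 2 ^ 3 + X 1 ^ 4 + 2 * (X 1 * X 3) + 2 * (X 1 * X 2 ^ 4 * X 3) : MvPolynomial (Fin 4) K) =
      X 2 ^ 3 + 4 * X 1 ^ 3 + 2 * X 3 + 2 * (X 2 ^ 4 * X 3) := by
    simp only [map_add, Derivation.leibniz, Derivation.leibniz_pow, smul_eq_mul, nsmul_eq_mul, e11, e12, e13, f_two]
    push_cast; ring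
  have d33 : pderiv 3 (X 1 * X 2 ^ 3 + X 1 ^ 4 + 2 * (X 1 * X 3) + 2 * (X 1 * X 2 ^ 4 * X 3) : MvPolynomial (Fin 4) K) =
      2 * (X 1 * (1 + X 2 ^ 4)) ^ 1 := by
    simp only [map_add, Derivation.leibniz, Derivation.leibniz_pow, smul_eq_mul, nsmul_eq_mul, e31, e32, e33, f_two]
    push_cast; ring
  have h1 := sq_mul_deriv_mem_pow 𝔫 h (pderiv 3)
  rw [d3] at h1
  -- `u''³ + t''³ ∈ 𝔫`, hence `t'' + u'' ∈ 𝔫`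
  have h31 := sq_mul_deriv_mem_pow 𝔫 h1 (pderiv 1)
  rw [d31, pow_one] at h31
  have hg : (X 2 ^ 3 + 4 * X 1 ^ 3 + 2 * X 3 + 2 * (X 2 ^ 4 * X 3) : MvPolynomial (Fin 4) K) ∈ 𝔫 :=
    (‹𝔫.IsPrime›.mem_or_mem h31).resolve_left hs4
  have hcube : (X 1 : MvPolynomial (Fin 4) K) ^ 3 + X 2 ^ 3 ∈ 𝔫 := by
    have := Ideal.sub_mem _ hg (Ideal.mul_mem_left _ (2 + 2 * X 2 ^ 4) hw)
    rw [show (X 2 ^ 3 + 4 * X 1 ^ 3 + 2 * X 3 + 2 * (X 2 ^ 4 * X 3) - (2 + 2 * X 2 ^ 4) * X 3 : MvPolynomial (Fin 4) K) =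
      X 1 ^ 3 + X 2 ^ 3 + 3 * X 1 ^ 3 by ring, three_eq_zero_mvPolynomial, zero_mul, add_zero] at this
    exact this
  have h12 : (X 1 + X 2 : MvPolynomial (Fin 4) K) ∈ 𝔫 := add_mem_of_cube_add_cube_mem 𝔫 hcube
  -- `e = t''(1 + u''⁴) ∈ 𝔫`
  have he : (X 1 * (1 + X 2 ^ 4) : MvPolynomial (Fin 4) K) ∈ 𝔫 := by
    have h3 := sq_mul_deriv_mem_pow 𝔫 h1 (pderiv 3)
    rw [d33] at h3
    exact mem_of_mul_mul_pow_mem_pow 𝔫 one_ne_zero hs4 h2 h3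
  -- `z'' ∈ 𝔫`
  have hf : (X 0 ^ 3 + X 1 * X 3 * (X 3 + X 2 ^ 3 + X 1 ^ 3 + X 2 ^ 4 * X 3) : MvPolynomial (Fin 4) K) ∈ 𝔫 :=
    (‹𝔫.IsPrime›.mem_or_mem (Ideal.pow_le_self three_ne_zero h)).resolve_left hs
  have hX0 : (X 0 : MvPolynomial (Fin 4) K) ∈ 𝔫 := by
    refine ‹𝔫.IsPrime›.mem_of_pow_mem 3 ?_
    have := Ideal.sub_mem _ hf (Ideal.mul_mem_left _ (X 1) (Ideal.mul_mem_right (X 3 + X 2 ^ 3 + X 1 ^ 3 + X 2 ^ 4 * X 3) _ hw))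
    rwa [show (X 0 ^ 3 + X 1 * X 3 * (X 3 + X 2 ^ 3 + X 1 ^ 3 + X 2 ^ 4 * X 3) - X 1 * (X 3 * (X 3 + X 2 ^ 3 + X 1 ^ 3 + X 2 ^ 4 * X 3)) :
      MvPolynomial (Fin 4) K) = X 0 ^ 3 by ring] at this
  refine ⟨hX0, h12, he, fun s' hs' hmem => ?_⟩
  -- TAMENESS: `e` is a regular parameter at `𝔫`
  have hs'2 : s' ^ 2 ∉ 𝔫 := pow_not_mem 𝔫 hs' 2
  have de1 : pderiv 1 (X 1 * (1 + X 2 ^ 4) : MvPolynomial (Fin 4) K) = 1 * (1 + X 2 ^ 4) ^ 1 := by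
    simp only [map_add, Derivation.leibniz, Derivation.leibniz_pow, smul_eq_mul, nsmul_eq_mul, e11, e12, f_one]
    push_cast; ring
  have de2 : pderiv 2 (X 1 * (1 + X 2 ^ 4) : MvPolynomial (Fin 4) K) = 4 * (X 1 * X 2 ^ 3) := by
    simp only [map_add, Derivation.leibniz, Derivation.leibniz_pow, smul_eq_mul, nsmul_eq_mul, e21, e22, f_one]
    push_cast; ring
  have h1X2 : (1 + X 2 ^ 4 : MvPolynomial (Fin 4) K) ∈ 𝔫 := by
    have h3 := sq_mul_deriv_mem_pow 𝔫 hmem (pderiv 1)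
    rw [de1] at h3
    exact mem_of_mul_mul_pow_mem_pow 𝔫 one_ne_zero hs'2 (one_not_mem_of_isPrime 𝔫) h3
  have h3 := sq_mul_deriv_mem_pow 𝔫 hmem (pderiv 2)
  rw [de2, pow_one] at h3
  have h123 : (X 1 * X 2 ^ 3 : MvPolynomial (Fin 4) K) ∈ 𝔫 := by
    rcases ‹𝔫.IsPrime›.mem_or_mem h3 with h' | h'
    · exact absurd h' hs'2
    rcases ‹𝔫.IsPrime›.mem_or_mem h' with h'' | h''
    · exact absurd h'' h4
    · exact h''
  have hX2 : (X 2 : MvPolynomial (Fin 4) K) ∈ 𝔫 := by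
    rcases ‹𝔫.IsPrime›.mem_or_mem h123 with hX1 | hX2
    · have := Ideal.sub_mem _ h12 hX1
      rwa [add_sub_cancel_left] at this
    · exact ‹𝔫.IsPrime›.mem_of_pow_mem 3 hX2
  have h1mem : (1 : MvPolynomial (Fin 4) K) ∈ 𝔫 := by
    have := Ideal.sub_mem _ h1X2 (Ideal.pow_mem_of_mem 𝔫 hX2 4 (by norm_num))
    rwa [add_sub_cancel_right] at this
  exact one_not_mem_of_isPrime 𝔫 h1mem

end RunCertificates

end Summit.ResolutionOfSingularities.ResolutionOfSingularities.Theorems.DeltaCutClasses
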